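import Summits.ResolutionOfSingularities.ResolutionOfSingularities.Theorems.FrobeniusClosingPatchingRelPerfectDepthOneDictionaryStepPow
import HarnessLib

/-!
# Crux `PatchingRelPerfect` (stmt-ResolutionOfSingularities-16161), chain w52 — R5 support:
# the CARRIER-GENERAL dictionary step (the carrier need NOT lie over the closed point)

[OURS · L1 W5.2 · rung tool] CRUX-PLAN v3.2a §6i (ii)(a) (res-L1-w52-plan-1 REPLY 03:49:36Z): rung R5
`JetRescueFour` runs the r-d1 dictionary on a carrier `H ↪ X` which is the strict transform of a regular
HYPERSURFACE `V(g) ⊂ Spec S` — `H` dominates `V(g)` and does NOT lie over the closed point, so the field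
`map_eq_closedPoint` of `DepthOneInvariant` / `DepthInvariant` («the carrier lies over the closed point»,
hypothesis `hEpt` of `DepthOne.dictionaryStep_pow`, p497259) «must move from the CARRIER to the CENTRES»
(tri-2 TRIAGE v5 04:42:45Z: «your (a) = put map_eq_closedPoint on CENTRES not on the carrier H′»).

This file does exactly that, fact-free, and then removes the per-step hypothesis altogether:

* `DepthOne.dictionaryStep_pow_centre` — `DepthOne.dictionaryStep_pow` (exponent `μ`, explicit FORMAT)
  with the carrier hypothesis `hEpt : ∀ e, g (i e) = 𝔪` REPLACED by the centre hypothesis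
  `hCpt : ∀ e ∈ supp C, g (i e) = 𝔪`; the conclusion is the same list of invariant fields minus
  «`E' ↦ 𝔪`» (which is false for a hypersurface carrier). In that proof `hEpt` is consumed in exactly two
  places: the dropped conjunct, and the cosupport of the pushed centre `C.map i` needed by
  `IsBlowup.exists_isBlowup_comp_supported` — here supplied by `hCpt` through
  `supp (C.map i) = i(supp C)` (`support_map_eq_image`).
* `DepthOne.dictionaryStep_pow_centre_controlledTransform` — the same with the carrier side READ OFF
  (`𝔟 := K|_H`, `K'|_{H'} = controlledTransform τ C (K|_H) μ`).
* `DepthOne.centre_over_closedPoint_of_le` / `DepthOne.cosupport_of_comap_le` — the two support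
  book-keeping lemmas: if `𝔟 = K|_H` is COSUPPORTED OVER THE CLOSED POINT and `K ≤ Ĉ^μ` with `1 ≤ μ`,
  every point of `supp C` lies over the closed point; and cosupport over the closed point passes to any
  `𝔟' ⊇ τ^*𝔟` on `H'`, in particular to the controlled transform.
* `DepthOne.dictionaryStep_pow_cosupport` — the SELF-REPRODUCING form R5 runs on: hypothesis «`K|_H` is
  cosupported over the closed point» and `1 ≤ μ`, NO hypothesis on the centre beyond `V(C)` regular and
  `K ≤ Ĉ^μ`; conclusion = all invariant fields for `(H', X', Bl(i), σ ≫ g, σᶜ(K, μ))` AND the same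
  cosupport for `σᶜ(K, μ)|_{H'} = τᶜ(K|_H, μ)`. Along a CJS-B run on `X = (E ∩ H)_red ⊂ Z = H`
  (tri-2's re-derivation of `JetRescueFour`: `K = (Q_i) + (x_i^{e+1})`, `H = V(Q_i)`,
  `𝔟 = 𝓘_E^{e+1}|_H` cosupported on `E ∩ H ⊆ g⁻¹𝔪`, lift `ℓ = 1`) the dictionary therefore needs no
  per-step input at all.
* `DepthOne.dictionaryStep_cosupport` — the same in D1's binder shape (`μ = 1`, `∃`-FORMAT, centre
  `C ⊇ 𝔟`, p495681) with «carrier over the closed point» replaced by «`𝔟` / `𝔟'` cosupported over the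
  closed point» on both sides: the shape an `inv_along`-style induction over `IsControlledSeq` consumes.

For the exceptional carrier `E` (r-d1, R4) `hEpt` implies every cosupport hypothesis here, so these are
generalisations of D1 / D_ℓ, not competitors; nothing in F1/F2 (`DepthTargets.*`) is touched.
Tools: exactly those of p497259 (BGMW 3.2.1 with exponent, GW 13.91 (1) / 13.96 (2), Liu 8.1.19 (a),
Cartier cancellation, the D1 kit `DepthOne.*`) plus Mathlib's `Scheme.IdealSheafData.support_map` /
`support_comap` / `support_antitone`. Fact-free; perfectness / residue field / characteristic / excellence
are used nowhere. Nothing here is a statement of the manuscript under review.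

## References

* E. Bierstone, D. Grigoriev, P. Milman, J. Włodarczyk (2011), §3.2 Lemma 3.2.1. [BierstoneGrigorievMilmanWlodarczyk2011]
* U. Görtz, T. Wedhorn, *Algebraic Geometry I* (2020), Prop. 13.91 (1), 13.96 (2). [GortzWedhorn2020]
* J. Kollár, *Lectures on Resolution of Singularities* (2007), (3.111) Step 3. [Kollar2007]
* Q. Liu (2002), Thm. 8.1.19 (a). [Liu2002]
-/

-- `Summit.<Summit>.<Sub>.Theorems` with `Sub = Summit` (single-conjunct summit, D-0017)
set_option linter.dupNamespace false

noncomputable section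

open CategoryTheory CategoryTheory.Limits AlgebraicGeometry TopologicalSpace
open Literature.AlgebraicGeometry.Resolution
open IsLocalRing

namespace Summit.ResolutionOfSingularities.ResolutionOfSingularities.Theorems

universe u

namespace DepthOne

section Support

variable {E X : Scheme.{u}} (i : E ⟶ X) [IsClosedImmersion i]

/-- The support of the pushed centre `C.map i` IS the image of the support of `C` (a closed immersion
is a closed map; sharpens `support_map_subset_range`). [folklore] -/
theorem support_map_eq_image (C : E.IdealSheafData) :
    ((C.map i).support : Set X) = i.base '' (C.support : Set E) := by
  rw [Scheme.IdealSheafData.support_map, Closeds.coe_closure,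
    (i.isClosedEmbedding.isClosedMap _ C.support.isClosed).closure_eq]

omit [IsClosedImmersion i] in
/-- `C^μ ≤ C` for `μ ≠ 0` (ideal sheaves). [folklore] -/
theorem pow_le_self_idealSheafData (C : E.IdealSheafData) {μ : ℕ} (hμ : μ ≠ 0) : C ^ μ ≤ C := by
  obtain ⟨n, rfl⟩ := Nat.exists_eq_succ_of_ne_zero hμ
  rw [pow_succ]
  exact fun _ => Ideal.mul_le_left

omit [IsClosedImmersion i] in
/-- **Centres over the closed point from cosupport.** If the carrier-side ideal `𝔟` is cosupported
over a set `P` of the base (`g (i e) ∈ P` for every `e ∈ supp 𝔟`) and the centre satisfies `𝔟 ≤ C ^ μ`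
with `μ ≠ 0`, then every point of `supp C` lies over `P`. [folklore] -/
theorem centre_over_of_le {B : Scheme.{u}} (g : X ⟶ B) (P : Set B) (𝔟 C : E.IdealSheafData)
    {μ : ℕ} (hμ : μ ≠ 0) (h𝔟C : 𝔟 ≤ C ^ μ)
    (h𝔟pt : ∀ e : E, e ∈ 𝔟.support → g.base (i.base e) ∈ P) :
    ∀ e : E, e ∈ C.support → g.base (i.base e) ∈ P := by
  intro e he
  have hle : 𝔟 ≤ C := h𝔟C.trans (pow_le_self_idealSheafData C hμ)
  exact h𝔟pt e (Scheme.IdealSheafData.support_antitone hle he)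

omit [IsClosedImmersion i] in
/-- **Cosupport passes up a blow-up of the carrier.** If `𝔟` on `E` is cosupported over `P` (through
`i ≫ g`), `τ : E' ⟶ E`, `i' : E' ⟶ X'`, `σ : X' ⟶ X` with `i' ≫ σ = τ ≫ i`, and `𝔟'` on `E'` contains
`τ^*𝔟`, then `𝔟'` is cosupported over `P` (through `i' ≫ σ ≫ g`). Applies to the controlled transform
(`comap_le_controlledTransform`) and to any `𝔟'` with `τ^*𝔟 = (τ^*C)^μ · 𝔟'`. [folklore] -/
theorem cosupport_of_comap_le {B E' X' : Scheme.{u}} (g : X ⟶ B) (P : Set B) (𝔟 : E.IdealSheafData)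
    (τ : E' ⟶ E) (i' : E' ⟶ X') (σ : X' ⟶ X) (hsq : i' ≫ σ = τ ≫ i) (𝔟' : E'.IdealSheafData)
    (hle : 𝔟.comap τ ≤ 𝔟')
    (h𝔟pt : ∀ e : E, e ∈ 𝔟.support → g.base (i.base e) ∈ P) :
    ∀ e' : E', e' ∈ 𝔟'.support → (σ ≫ g).base (i'.base e') ∈ P := by
  intro e' he'
  have h1 : e' ∈ (𝔟.comap τ).support := Scheme.IdealSheafData.support_antitone hle he'
  rw [Scheme.IdealSheafData.support_comap] at h1
  have h2 : g.base (i.base (τ.base e')) ∈ P := h𝔟pt (τ.base e') h1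
  have h3 : (i' ≫ σ).base e' = (τ ≫ i).base e' := by rw [hsq]
  simp only [Scheme.Hom.comp_base, TopCat.coe_comp, Function.comp_apply] at h3 ⊢
  rw [h3]
  exact h2

end Support

/-- **The carrier-general dictionary step with exponent `μ`** (explicit format): `S` regular local,
`i : E ⟶ X` a closed immersion of the regular carrier `E` (ANY regular effective Cartier divisor — an
exceptional divisor or the strict transform of a hypersurface) into the Noetherian regular `X`,
`g : X ⟶ Spec S` a blowing up cosupported in the closed point, FORMAT `I𝒪_X = M · K` with `M` effective
Cartier, `𝓘_E^μ ≤ K`, `K|_E = 𝔟`; one step `τ : E' ⟶ E` blowing up a centre `C` with `V(C)` regular,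
EVERY POINT OF `V(C)` OVER THE CLOSED POINT (`hCpt` — the hypothesis that replaces «`E ↦ 𝔪`» of
`dictionaryStep_pow`), `K ≤ (C.map i)^μ` and `𝔟𝒪_{E'} = (C𝒪_{E'})^μ · 𝔟'`. Then with
`σ : X' = Bl_{C.map i} X ⟶ X`, `i' = Bl(i)`, `M' = σ^*M · 𝓘_{exc}^μ`, `K' = σᶜ(K, μ)`: `X'` Noetherian
regular, `E'` regular, `i'` a closed immersion with `𝓘_{E'}` effective Cartier and
`𝓘_{exc} · 𝓘_{E'} = σ^*𝓘_E`, `σ ≫ g` a blowing up cosupported in `{𝔪}`, `M'` effective Cartier,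
`𝓘_{E'}^μ ≤ K'`, `K'|_{E'} = 𝔟'`, `I𝒪_{X'} = M' · K'`.
[cite: BierstoneGrigorievMilmanWlodarczyk2011, §3.2 Lemma 3.2.1] [cite: GortzWedhorn2020, Prop. 13.91 (1), Prop. 13.96 (2)]
[cite: Kollar2007, (3.111) Step 3] [cite: Liu2002, Thm. 8.1.19 (a)] -/
theorem dictionaryStep_pow_centre {S : Type u} [CommRing S] [IsRegularLocalRing S] (I : Ideal S) (μ : ℕ)
    {E X : Scheme.{u}} (i : E ⟶ X) (g : X ⟶ Spec (.of S)) (𝔟 : E.IdealSheafData)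
    [IsNoetherian X] (hX : Scheme.IsRegular X) (hE : Scheme.IsRegular E)
    [IsClosedImmersion i] (hiE : IsEffectiveCartier i.ker)
    (hg : ∃ K₀ : (Spec (.of S)).IdealSheafData, IsBlowup g K₀ ∧
      (K₀.support : Set (Spec (.of S))) ⊆ {IsLocalRing.closedPoint S})
    (M K : X.IdealSheafData) (hM : IsEffectiveCartier M) (hkerK : i.ker ^ μ ≤ K) (hKE : K.comap i = 𝔟)
    (hIMK : (affineBlowup.idealSheaf I).comap g = M * K)
    {E' : Scheme.{u}} (τ : E' ⟶ E) (C : E.IdealSheafData) (𝔟' : E'.IdealSheafData)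
    (hC : Scheme.IsRegular C.subscheme)
    (hCpt : ∀ e : E, e ∈ C.support → g.base (i.base e) = IsLocalRing.closedPoint S)
    (hKC : K ≤ (C.map i) ^ μ) (hτ : IsBlowup τ C)
    (hctrl : 𝔟.comap τ = C.comap τ ^ μ * 𝔟') :
    ∃ (X' : Scheme.{u}) (σ : X' ⟶ X) (hσ : IsBlowup σ (C.map i))
      (hτ' : IsBlowup τ ((C.map i).comap i)),
      IsNoetherian X' ∧ Scheme.IsRegular X' ∧ Scheme.IsRegular E' ∧
      IsClosedImmersion (hσ.strictTransformHom hτ') ∧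
      IsEffectiveCartier (hσ.strictTransformHom hτ').ker ∧
      (C.map i).comap σ * (hσ.strictTransformHom hτ').ker = i.ker.comap σ ∧
      (∃ K' : (Spec (.of S)).IdealSheafData, IsBlowup (σ ≫ g) K' ∧
        (K'.support : Set (Spec (.of S))) ⊆ {IsLocalRing.closedPoint S}) ∧
      IsEffectiveCartier (M.comap σ * (C.map i).comap σ ^ μ) ∧
      (hσ.strictTransformHom hτ').ker ^ μ ≤ controlledTransform σ (C.map i) K μ ∧
      (controlledTransform σ (C.map i) K μ).comap (hσ.strictTransformHom hτ') = 𝔟' ∧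
      (affineBlowup.idealSheaf I).comap (σ ≫ g) =
        (M.comap σ * (C.map i).comap σ ^ μ) * controlledTransform σ (C.map i) K μ := by
  -- the centre pushed into `X`
  set Ch : X.IdealSheafData := C.map i with hCh
  have hkerCh : i.ker ≤ Ch := ker_le_map_centre i C
  have hChE : Ch.comap i = C := comap_map_centre i C
  have hChreg : Scheme.IsRegular Ch.subscheme := isRegular_subscheme_map i C hC
  -- blow `X` up along `Ch`
  obtain ⟨X', σ, hσ⟩ := exists_isBlowup X Ch
  have hτ' : IsBlowup τ (Ch.comap i) := by rw [hChE]; exact hτ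
  refine ⟨X', σ, hσ, hτ', ?_⟩
  -- the strict-transform morphism
  set i' : E' ⟶ X' := hσ.strictTransformHom hτ' with hi'def
  have hsq : i' ≫ σ = τ ≫ i := hσ.strictTransformHom_comp hτ'
  haveI hi' : IsClosedImmersion i' := hσ.isClosedImmersion_of_comp_eq hτ' hsq
  -- `X'` is Noetherian and regular, `E'` is regular
  haveI : IsProper σ := hσ.isProper
  haveI : IsLocallyNoetherian X' := LocallyOfFiniteType.isLocallyNoetherian σ
  haveI : CompactSpace X' := QuasiCompact.compactSpace_of_compactSpace σ
  have hX'N : IsNoetherian X' := {}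
  have hX'reg : Scheme.IsRegular X' := hσ.isRegular_of_isRegular_subscheme hX hChreg
  haveI : IsLocallyNoetherian E := LocallyOfFiniteType.isLocallyNoetherian i
  have hE'reg : Scheme.IsRegular E' := hτ.isRegular_of_isRegular_subscheme hE hC
  -- the ideal of the strict transform
  have hker : i'.ker = controlledTransform σ Ch i.ker 1 :=
    hσ.ker_strictTransformHom_of_isRegular hX hChreg hτ' hkerCh (isRegular_subscheme_ker i hE)
  have hexc : IsEffectiveCartier (Ch.comap σ) := hσ.isEffectiveCartier
  have hkerfac : Ch.comap σ * i'.ker = i.ker.comap σ := by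
    rw [hker]; exact hσ.comap_mul_controlledTransform_one hkerCh
  have hkerE' : IsEffectiveCartier i'.ker := by
    have h2 : IsEffectiveCartier (i.ker.comap σ) := hiE.comap_of_isBlowup hσ
    rw [← hkerfac] at h2
    exact h2.of_mul_right
  -- the controlled transform with exponent `μ`
  have hKK' : Ch.comap σ ^ μ * controlledTransform σ Ch K μ = K.comap σ :=
    hσ.pow_mul_controlledTransform_eq (by
      rw [← comap_pow]; exact Scheme.IdealSheafData.comap_mono (f := σ) hKC)
  refine ⟨hX'N, hX'reg, hE'reg, hi', hkerE', hkerfac, ?_, (hM.comap_of_isBlowup hσ).mul (hexc.pow μ),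
    ?_, ?_, ?_⟩
  · -- `σ ≫ g` is a blowing up cosupported in the closed point: the CENTRE lies over the closed point
    obtain ⟨K₀, hgK, hKsupp⟩ := hg
    have hChsupp : (Ch.support : Set X) ⊆ g.base ⁻¹' {IsLocalRing.closedPoint S} := by
      intro x hx
      have hx' : x ∈ ((C.map i).support : Set X) := hx
      rw [support_map_eq_image i C] at hx'
      obtain ⟨e, he, rfl⟩ := hx'
      exact hCpt e he
    obtain ⟨Q, hQ, hQsupp⟩ := hgK.exists_isBlowup_comp_supported g K₀ σ Ch
      {IsLocalRing.closedPoint S} hKsupp hσ hChsupp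
    exact ⟨Q, hQ, hQsupp⟩
  · -- `𝓘_{E'}^μ ≤ K'`: cancel `𝓘_{exc}^μ` in `𝓘_{exc}^μ 𝓘_{E'}^μ = σ^*(𝓘_E^μ) ≤ σ^*K`
    rw [controlledTransform, le_colon_iff]
    calc Ch.comap σ ^ μ * i'.ker ^ μ = (Ch.comap σ * i'.ker) ^ μ := by rw [mul_pow]
      _ = (i.ker ^ μ).comap σ := by rw [hkerfac, comap_pow]
      _ ≤ K.comap σ := Scheme.IdealSheafData.comap_mono (f := σ) hkerK
  · -- `K'|_{E'} = 𝔟'`: cancel the effective Cartier divisor `(C𝒪_{E'})^μ`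
    apply (hτ.isEffectiveCartier.pow μ).eq_of_mul_eq_mul
    have h1 : (Ch.comap σ).comap i' = C.comap τ := by
      rw [← Scheme.IdealSheafData.comap_comp, hsq, Scheme.IdealSheafData.comap_comp, hChE]
    have h2 : (K.comap σ).comap i' = 𝔟.comap τ := by
      rw [← Scheme.IdealSheafData.comap_comp, hsq, Scheme.IdealSheafData.comap_comp, hKE]
    rw [← hctrl, ← h2, ← hKK', comap_mul, comap_pow, h1]
  · -- `I𝒪_{X'} = σ^*M · 𝓘_{exc}^μ · K'`
    rw [Scheme.IdealSheafData.comap_comp, hIMK, comap_mul, ← hKK', mul_assoc]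

/-- **Carrier-general dictionary step, controlled-transform form**: as `dictionaryStep_pow_centre` with
the carrier side read off — `𝔟 := K|_E` and `K'|_{E'} = controlledTransform τ C (K|_E) μ`.
[cite: BierstoneGrigorievMilmanWlodarczyk2011, §3.2 Lemma 3.2.1] [cite: GortzWedhorn2020, Prop. 13.91 (1), Prop. 13.96 (2)] -/
theorem dictionaryStep_pow_centre_controlledTransform {S : Type u} [CommRing S] [IsRegularLocalRing S]
    (I : Ideal S) (μ : ℕ)
    {E X : Scheme.{u}} (i : E ⟶ X) (g : X ⟶ Spec (.of S))
    [IsNoetherian X] (hX : Scheme.IsRegular X) (hE : Scheme.IsRegular E)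
    [IsClosedImmersion i] (hiE : IsEffectiveCartier i.ker)
    (hg : ∃ K₀ : (Spec (.of S)).IdealSheafData, IsBlowup g K₀ ∧
      (K₀.support : Set (Spec (.of S))) ⊆ {IsLocalRing.closedPoint S})
    (M K : X.IdealSheafData) (hM : IsEffectiveCartier M) (hkerK : i.ker ^ μ ≤ K)
    (hIMK : (affineBlowup.idealSheaf I).comap g = M * K)
    {E' : Scheme.{u}} (τ : E' ⟶ E) (C : E.IdealSheafData)
    (hC : Scheme.IsRegular C.subscheme)
    (hCpt : ∀ e : E, e ∈ C.support → g.base (i.base e) = IsLocalRing.closedPoint S)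
    (hKC : K ≤ (C.map i) ^ μ) (hτ : IsBlowup τ C) :
    ∃ (X' : Scheme.{u}) (σ : X' ⟶ X) (hσ : IsBlowup σ (C.map i))
      (hτ' : IsBlowup τ ((C.map i).comap i)),
      IsNoetherian X' ∧ Scheme.IsRegular X' ∧ Scheme.IsRegular E' ∧
      IsClosedImmersion (hσ.strictTransformHom hτ') ∧
      IsEffectiveCartier (hσ.strictTransformHom hτ').ker ∧
      (C.map i).comap σ * (hσ.strictTransformHom hτ').ker = i.ker.comap σ ∧
      (∃ K' : (Spec (.of S)).IdealSheafData, IsBlowup (σ ≫ g) K' ∧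
        (K'.support : Set (Spec (.of S))) ⊆ {IsLocalRing.closedPoint S}) ∧
      IsEffectiveCartier (M.comap σ * (C.map i).comap σ ^ μ) ∧
      (hσ.strictTransformHom hτ').ker ^ μ ≤ controlledTransform σ (C.map i) K μ ∧
      (controlledTransform σ (C.map i) K μ).comap (hσ.strictTransformHom hτ') =
        controlledTransform τ C (K.comap i) μ ∧
      (affineBlowup.idealSheaf I).comap (σ ≫ g) =
        (M.comap σ * (C.map i).comap σ ^ μ) * controlledTransform σ (C.map i) K μ := by
  -- the carrier side: `K|_E 𝒪_{E'} = (C𝒪_{E'})^μ · τᶜ(K|_E, μ)` (BGMW 3.2.1 with exponent `μ` on `E`)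
  have hle : (K.comap i).comap τ ≤ C.comap τ ^ μ := by
    have h1 : K.comap i ≤ C ^ μ := by
      have h : K.comap i ≤ ((C.map i) ^ μ).comap i := Scheme.IdealSheafData.comap_mono (f := i) hKC
      rwa [comap_pow, comap_map_centre i C] at h
    have h : (K.comap i).comap τ ≤ (C ^ μ).comap τ := Scheme.IdealSheafData.comap_mono (f := τ) h1
    rwa [comap_pow] at h
  have hctrl : (K.comap i).comap τ = C.comap τ ^ μ * controlledTransform τ C (K.comap i) μ :=
    (hτ.pow_mul_controlledTransform_eq hle).symm
  exact dictionaryStep_pow_centre I μ i g (K.comap i) hX hE hiE hg M K hM hkerK rfl hIMK τ C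
    (controlledTransform τ C (K.comap i) μ) hC hCpt hKC hτ hctrl

/-- **The self-reproducing COSUPPORT form** (what rung R5 runs on): as
`dictionaryStep_pow_centre_controlledTransform`, but instead of a hypothesis on the centre we assume
`1 ≤ μ` and that the carrier-side ideal `K|_E` is COSUPPORTED OVER THE CLOSED POINT
(`∀ e ∈ supp K|_E, g (i e) = 𝔪`); then every permissible centre (`K ≤ (C.map i)^μ`) lies over the
closed point automatically (`centre_over_of_le`), and the conclusion records, in addition to every
invariant field, that the new carrier-side ideal `σᶜ(K, μ)|_{E'} = τᶜ(K|_E, μ)` is again cosupported over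
the closed point (`cosupport_of_comap_le`) — so the hypothesis reproduces itself along any sequence of
such steps and no per-step input is needed. [cite: BierstoneGrigorievMilmanWlodarczyk2011, §3.2 Lemma 3.2.1]
[cite: GortzWedhorn2020, Prop. 13.91 (1), Prop. 13.96 (2)] [cite: Kollar2007, (3.111) Step 3] -/
theorem dictionaryStep_pow_cosupport {S : Type u} [CommRing S] [IsRegularLocalRing S]
    (I : Ideal S) {μ : ℕ} (hμ : 1 ≤ μ)
    {E X : Scheme.{u}} (i : E ⟶ X) (g : X ⟶ Spec (.of S))
    [IsNoetherian X] (hX : Scheme.IsRegular X) (hE : Scheme.IsRegular E)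
    [IsClosedImmersion i] (hiE : IsEffectiveCartier i.ker)
    (hg : ∃ K₀ : (Spec (.of S)).IdealSheafData, IsBlowup g K₀ ∧
      (K₀.support : Set (Spec (.of S))) ⊆ {IsLocalRing.closedPoint S})
    (M K : X.IdealSheafData) (hM : IsEffectiveCartier M) (hkerK : i.ker ^ μ ≤ K)
    (hKpt : ∀ e : E, e ∈ (K.comap i).support → g.base (i.base e) = IsLocalRing.closedPoint S)
    (hIMK : (affineBlowup.idealSheaf I).comap g = M * K)
    {E' : Scheme.{u}} (τ : E' ⟶ E) (C : E.IdealSheafData)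
    (hC : Scheme.IsRegular C.subscheme) (hKC : K ≤ (C.map i) ^ μ) (hτ : IsBlowup τ C) :
    ∃ (X' : Scheme.{u}) (σ : X' ⟶ X) (hσ : IsBlowup σ (C.map i))
      (hτ' : IsBlowup τ ((C.map i).comap i)),
      IsNoetherian X' ∧ Scheme.IsRegular X' ∧ Scheme.IsRegular E' ∧
      IsClosedImmersion (hσ.strictTransformHom hτ') ∧
      IsEffectiveCartier (hσ.strictTransformHom hτ').ker ∧
      (C.map i).comap σ * (hσ.strictTransformHom hτ').ker = i.ker.comap σ ∧
      (∃ K' : (Spec (.of S)).IdealSheafData, IsBlowup (σ ≫ g) K' ∧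
        (K'.support : Set (Spec (.of S))) ⊆ {IsLocalRing.closedPoint S}) ∧
      IsEffectiveCartier (M.comap σ * (C.map i).comap σ ^ μ) ∧
      (hσ.strictTransformHom hτ').ker ^ μ ≤ controlledTransform σ (C.map i) K μ ∧
      (controlledTransform σ (C.map i) K μ).comap (hσ.strictTransformHom hτ') =
        controlledTransform τ C (K.comap i) μ ∧
      (affineBlowup.idealSheaf I).comap (σ ≫ g) =
        (M.comap σ * (C.map i).comap σ ^ μ) * controlledTransform σ (C.map i) K μ ∧
      (∀ e' : E', e' ∈ ((controlledTransform σ (C.map i) K μ).comap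
          (hσ.strictTransformHom hτ')).support →
        (σ ≫ g).base ((hσ.strictTransformHom hτ').base e') = IsLocalRing.closedPoint S) := by
  -- the centre lies over the closed point: `K|_E ≤ C^μ ≤ C`
  have hKCE : K.comap i ≤ C ^ μ := by
    have h : K.comap i ≤ ((C.map i) ^ μ).comap i := Scheme.IdealSheafData.comap_mono (f := i) hKC
    rwa [comap_pow, comap_map_centre i C] at h
  have hCpt : ∀ e : E, e ∈ C.support → g.base (i.base e) = IsLocalRing.closedPoint S := by
    have h := centre_over_of_le i g {IsLocalRing.closedPoint S} (K.comap i) C (μ := μ) (by omega)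
      hKCE (fun e he => hKpt e he)
    exact fun e he => h e he
  obtain ⟨X', σ, hσ, hτ', hN, hreg, hreg', hci, hcart, hfac, hbl, hM', hkerK', hK'E, hfmt⟩ :=
    dictionaryStep_pow_centre_controlledTransform I μ i g hX hE hiE hg M K hM hkerK hIMK τ C hC hCpt
      hKC hτ
  refine ⟨X', σ, hσ, hτ', hN, hreg, hreg', hci, hcart, hfac, hbl, hM', hkerK', hK'E, hfmt, ?_⟩
  -- cosupport of the new carrier-side ideal: it contains `τ^*(K|_E)`
  have hsq : hσ.strictTransformHom hτ' ≫ σ = τ ≫ i := hσ.strictTransformHom_comp hτ'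
  rw [hK'E]
  have h := cosupport_of_comap_le i g {IsLocalRing.closedPoint S} (K.comap i) τ
    (hσ.strictTransformHom hτ') σ hsq (controlledTransform τ C (K.comap i) μ)
    (comap_le_controlledTransform τ C (K.comap i) μ) (fun e he => hKpt e he)
  exact fun e' he' => h e' he'

/-- **The carrier-general dictionary step in D1's binder shape** (`μ = 1`, `∃`-FORMAT, centre
`C ⊇ 𝔟`): `DepthOne.dictionaryStep` (p495681) with its sixth hypothesis / sixth conclusion «the carrier
lies over the closed point» replaced by «`𝔟` (resp. `𝔟'`) is COSUPPORTED over the closed point». This is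
the shape an `inv_along`-style induction over `DepthOneTargets.IsControlledSeq` consumes, for a carrier
that is the strict transform of a hypersurface (rung R5): the cosupport clause travels with the sequence.
[cite: GortzWedhorn2020, Prop. 13.91 (1), Prop. 13.96 (2)] [cite: BierstoneGrigorievMilmanWlodarczyk2011, §3.2 Lemma 3.2.1]
[cite: Kollar2007, (3.111) Step 3] [cite: Liu2002, Thm. 8.1.19 (a)] -/
theorem dictionaryStep_cosupport {S : Type u} [CommRing S] [IsRegularLocalRing S] (I : Ideal S)
    {E X : Scheme.{u}} (i : E ⟶ X) (g : X ⟶ Spec (.of S)) (𝔟 : E.IdealSheafData)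
    (hXN : IsNoetherian X) (hX : Scheme.IsRegular X) (hE : Scheme.IsRegular E)
    (hi : IsClosedImmersion i) (hiE : IsEffectiveCartier i.ker)
    (h𝔟pt : ∀ e : E, e ∈ 𝔟.support → g.base (i.base e) = IsLocalRing.closedPoint S)
    (hg : ∃ K : (Spec (.of S)).IdealSheafData, IsBlowup g K ∧
      (K.support : Set (Spec (.of S))) ⊆ {IsLocalRing.closedPoint S})
    (hfmt : ∃ M K : X.IdealSheafData, IsEffectiveCartier M ∧ i.ker ≤ K ∧ K.comap i = 𝔟 ∧
      (affineBlowup.idealSheaf I).comap g = M * K)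
    {E' : Scheme.{u}} (τ : E' ⟶ E) (C : E.IdealSheafData) (𝔟' : E'.IdealSheafData)
    (hC : Scheme.IsRegular C.subscheme) (hle : 𝔟 ≤ C) (hτ : IsBlowup τ C)
    (hctrl : 𝔟.comap τ = C.comap τ * 𝔟') :
    ∃ (X' : Scheme.{u}) (i' : E' ⟶ X') (g' : X' ⟶ Spec (.of S)),
      IsNoetherian X' ∧ Scheme.IsRegular X' ∧ Scheme.IsRegular E' ∧ IsClosedImmersion i' ∧
      IsEffectiveCartier i'.ker ∧
      (∀ e' : E', e' ∈ 𝔟'.support → g'.base (i'.base e') = IsLocalRing.closedPoint S) ∧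
      (∃ K' : (Spec (.of S)).IdealSheafData, IsBlowup g' K' ∧
        (K'.support : Set (Spec (.of S))) ⊆ {IsLocalRing.closedPoint S}) ∧
      (∃ M' K' : X'.IdealSheafData, IsEffectiveCartier M' ∧ i'.ker ≤ K' ∧ K'.comap i' = 𝔟' ∧
        (affineBlowup.idealSheaf I).comap g' = M' * K') := by
  haveI := hXN
  haveI := hi
  obtain ⟨M, K, hM, hkerK, hKE, hIMK⟩ := hfmt
  -- the X-side order condition `K ≤ C.map i` from `K|_E = 𝔟 ≤ C`
  have hKC : K ≤ (C.map i) ^ 1 := by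
    rw [pow_one, Scheme.IdealSheafData.le_map_iff_comap_le, hKE]
    exact hle
  -- the centre lies over the closed point: `supp C ⊆ supp 𝔟`
  have hCpt : ∀ e : E, e ∈ C.support → g.base (i.base e) = IsLocalRing.closedPoint S :=
    fun e he => h𝔟pt e (Scheme.IdealSheafData.support_antitone hle he)
  have hkerK1 : i.ker ^ 1 ≤ K := by rw [pow_one]; exact hkerK
  have hctrl1 : 𝔟.comap τ = C.comap τ ^ 1 * 𝔟' := by rw [pow_one]; exact hctrl
  obtain ⟨X', σ, hσ, hτ', hN, hreg, hreg', hci, hcart, -, hbl, hM', hkerK', hK'E, hfmt'⟩ :=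
    dictionaryStep_pow_centre I 1 i g 𝔟 hX hE hiE hg M K hM hkerK1 hKE hIMK τ C 𝔟' hC hCpt hKC hτ
      hctrl1
  have hsq : hσ.strictTransformHom hτ' ≫ σ = τ ≫ i := hσ.strictTransformHom_comp hτ'
  refine ⟨X', hσ.strictTransformHom hτ', σ ≫ g, hN, hreg, hreg', hci, hcart, ?_, hbl,
    M.comap σ * (C.map i).comap σ ^ 1, controlledTransform σ (C.map i) K 1, hM', ?_, hK'E, hfmt'⟩
  · -- cosupport of `𝔟' ⊇ τ^*𝔟`
    have hle' : 𝔟.comap τ ≤ 𝔟' := by rw [hctrl]; exact fun _ => Ideal.mul_le_left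
    exact cosupport_of_comap_le i g {IsLocalRing.closedPoint S} 𝔟 τ (hσ.strictTransformHom hτ') σ hsq
      𝔟' hle' (fun e he => h𝔟pt e he)
  · simpa only [pow_one] using hkerK'

end DepthOne

end Summit.ResolutionOfSingularities.ResolutionOfSingularities.Theorems

end
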